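import Summits.MatrixMultiplication.MatrixMultiplication.Theses.DefinableSTPPDichotomy
import Literature.Barriers.MatrixMultiplication.TricoloredSumFreeBarrierEffective

/-!
# Refutation of `DefinableSTPPDichotomy.HexagonClearance` (stmt-MatrixMultiplication-18075)

`HexagonClearance` quantifies over ALL `ε > 0` and ALL finite fields.  For `ε > 1` its two
hypotheses (the `≥ 2`-equal-label STPP patterns and the mass bound at exponent `(2+ε)/3`) are met by
LABEL-ONLY "parasite" families whose blocks are far from tight, and in BOUNDED characteristic the
conclusion then contradicts the cap-set theorem.

The witness (for every `q₁`): `F = GF(3ⁿ)` (`n` large), rank `m = 2`, labels `x ∈ I = F` (`e = 1`,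
no parameters), blocks `A_x = {x} × F` (a line), `B_x = {(0,0)}`, `C_x = {(−x,−x)}` — ring-formula
definable (`v₀ = x₀`; `v₀ = 0 ∧ v₁ = 0`; `v₀ + x₀ = 0 ∧ v₁ + x₀ = 0`).  Every 2-equal-label pattern
holds (the label maps `x ↦ x, x, −2x` are injective, `char F ≠ 2`), and with `ε = 4`, `η = 1` the
mass is `Σ_x (q·1·1)^{(2+4)/3} = q · q² = q^{2+1}` exactly.  But a sub-family `J` satisfies the FULL
clause iff `{(x, x, −2x) : x ∈ J} = {(x,x,x)}` is tricolored sum-free in `(F,+) ≅ 𝔽₃ⁿ`, i.e. iff `J`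
is a cap set, so `|J| ≤ 3·q^{1−c₃}` (`c₃ = foxLovaszExponent 3 > 0`, Ellenberg–Gijswijt /
BCCGNSU Thm 4.14, PROVED in the tree: `card_le_rpow_of_elementary`), while the conclusion at
`δ = c₃/2` demands `q^{3−c₃/2} ≤ |J|·q²`, i.e. `|J| ≥ q^{1−c₃/2} > 3·q^{1−c₃}` once `q^{c₃/2} > 3`.
-/

/-- **Record of the dropped route item `HexagonClearance`** = stmt-MatrixMultiplication-18075 (ledger signature verbatim; NOT a route
item): route DefinableSTPPDichotomy rev 4 (2026-08-17T04:53Z) dropped the refuted `HexagonClearance` (repaired as `HexagonClearanceR`). The declaration `Summit.MatrixMultiplication.MatrixMultiplication.Theses.DefinableSTPPDichotomy.HexagonClearance`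
therefore no longer exists in the route file and this accepted module stopped elaborating (stale olean;
buildfix lane 2026-08-19). Re-created here under its original name so the result keeps building; the
statement of every previously accepted declaration in this file is unchanged. -/
def _root_.Summit.MatrixMultiplication.MatrixMultiplication.Theses.DefinableSTPPDichotomy.HexagonClearance : Prop :=
  ∀ (e m k : ℕ) (φI : FirstOrder.Language.ring.Formula (Fin e ⊕ Fin k)) (φA φB φC : FirstOrder.Language.ring.Formula ((Fin e ⊕ Fin m) ⊕ Fin k)), ∀ ε η δ : ℝ, 0 < ε → 0 < η → 0 < δ → ∃ q₁ : ℕ, ∀ (F : Type) [Field F] [Fintype F] [FirstOrder.Ring.CompatibleRing F], q₁ ≤ Fintype.card F → ∀ (y : Fin k → F) (I : Finset (Fin e → F)) (A B C : (Fin e → F) → Finset (Fin m → F)), (∀ x, x ∈ I ↔ φI.Realize (Sum.elim x y)) → (∀ x v, v ∈ A x ↔ φA.Realize (Sum.elim (Sum.elim x v) y)) → (∀ x v, v ∈ B x ↔ φB.Realize (Sum.elim (Sum.elim x v) y)) → (∀ x v, v ∈ C x ↔ φC.Realize (Sum.elim (Sum.elim x v) y)) → (∀ i ∈ I, ∀ j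 ∈ I, ∀ k ∈ I, (i = j ∨ j = k ∨ k = i) → ∀ s ∈ A k, ∀ s' ∈ A i, ∀ t ∈ B i, ∀ t' ∈ B j, ∀ u ∈ C j, ∀ u' ∈ C k, (s' - s) + (t' - t) + (u' - u) = 0 → i = j ∧ j = k ∧ s = s' ∧ t = t' ∧ u = u') → (Fintype.card F : ℝ) ^ ((m : ℝ) + η) ≤ ∑ x ∈ I, (((A x).card * (B x).card * (C x).card : ℕ) : ℝ) ^ ((2 + ε) / 3) → ∃ J : Finset (Fin e → F), J ⊆ I ∧ (∀ i ∈ J, ∀ j ∈ J, ∀ k ∈ J, ∀ s ∈ A k, ∀ s' ∈ A i, ∀ t ∈ B i, ∀ t' ∈ B j, ∀ u ∈ C j, ∀ u' ∈ C k, (s' - s) + (t' - t) + (u' - u) = 0 → i = j ∧ j = k ∧ s = s' ∧ t = t' ∧ u = u') ∧ (Fintype.card F : ℝ) ^ ((m : ℝ) + η - δ) ≤ ∑ x ∈ J, (((A x).card * (B x).card * (C x).card : ℕ) : ℝ) ^ ((2 + ε) / 3)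


-- `Summit.<Summit>.<Problem>` is the tree's mandated summit-side namespace; for this
-- single-conjunct summit the two coincide, so the file silences `dupNamespace`.
set_option linter.dupNamespace false

namespace Summit.MatrixMultiplication.MatrixMultiplication.Theorems

open Finset FirstOrder FirstOrder.Language

noncomputable section

section Parasite

/-- The `A`-blocks of the parasite family: the vertical line `{v ∈ F² : v₀ = x₀}`. [folklore] -/
private def lineA (F : Type) [Fintype F] [DecidableEq F] (x : Fin 1 → F) : Finset (Fin 2 → F) :=
  univ.filter fun v => v 0 = x 0

/-- The `B`-blocks of the parasite family: the origin. [folklore] -/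
private def ptB (F : Type) [Field F] (_x : Fin 1 → F) : Finset (Fin 2 → F) := {0}

/-- The `C`-blocks of the parasite family: the point `(−x₀, −x₀)`. [folklore] -/
private def ptC (F : Type) [Field F] (x : Fin 1 → F) : Finset (Fin 2 → F) := {fun _ => -(x 0)}

/-- Ring formula `v₀ = x₀` (variables: label `x : Fin 1`, vector `v : Fin 2`, no parameters).
[folklore] -/
private def φA : Language.ring.Formula ((Fin 1 ⊕ Fin 2) ⊕ Fin 0) :=
  Term.equal (Term.var (Sum.inl (Sum.inr 0))) (Term.var (Sum.inl (Sum.inl 0)))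

/-- Ring formula `v₀ = 0 ∧ v₁ = 0`. [folklore] -/
private def φB : Language.ring.Formula ((Fin 1 ⊕ Fin 2) ⊕ Fin 0) :=
  Term.equal (Term.var (Sum.inl (Sum.inr 0))) 0 ⊓ Term.equal (Term.var (Sum.inl (Sum.inr 1))) 0

/-- Ring formula `v₀ + x₀ = 0 ∧ v₁ + x₀ = 0`. [folklore] -/
private def φC : Language.ring.Formula ((Fin 1 ⊕ Fin 2) ⊕ Fin 0) :=
  Term.equal (Term.var (Sum.inl (Sum.inr 0)) + Term.var (Sum.inl (Sum.inl 0))) 0 ⊓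
    Term.equal (Term.var (Sum.inl (Sum.inr 1)) + Term.var (Sum.inl (Sum.inl 0))) 0

/-- Membership in `A_x`. [folklore] -/
private theorem mem_lineA {F : Type} [Fintype F] [DecidableEq F] {x : Fin 1 → F} {v : Fin 2 → F} :
    v ∈ lineA F x ↔ v 0 = x 0 := by
  simp [lineA]

/-- Membership in `B_x`. [folklore] -/
private theorem mem_ptB {F : Type} [Field F] {x : Fin 1 → F} {v : Fin 2 → F} :
    v ∈ ptB F x ↔ v = 0 :=
  Finset.mem_singleton

/-- Membership in `C_x`. [folklore] -/
private theorem mem_ptC {F : Type} [Field F] {x : Fin 1 → F} {v : Fin 2 → F} :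
    v ∈ ptC F x ↔ v = fun _ => -(x 0) :=
  Finset.mem_singleton

/-- `|A_x| = |F|`. [folklore] -/
private theorem card_lineA {F : Type} [Fintype F] [DecidableEq F] (x : Fin 1 → F) :
    (lineA F x).card = Fintype.card F := by
  rw [← Finset.card_univ (α := F)]
  refine Finset.card_nbij' (fun v => v 1) (fun z l => if l = 0 then x 0 else z) ?_ ?_ ?_ ?_
  · intro v _
    simp
  · intro z _
    simp [mem_lineA]
  · intro v hv
    have hv0 : v 0 = x 0 := mem_lineA.1 (Finset.mem_coe.1 hv)
    funext l
    fin_cases l <;> simp [hv0]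
  · intro z _
    simp

/-- `|B_x| = 1`. [folklore] -/
private theorem card_ptB {F : Type} [Field F] (x : Fin 1 → F) : (ptB F x).card = 1 :=
  Finset.card_singleton _

/-- `|C_x| = 1`. [folklore] -/
private theorem card_ptC {F : Type} [Field F] (x : Fin 1 → F) : (ptC F x).card = 1 :=
  Finset.card_singleton _

/-- Realisation of `φA`: `A_x` is the definable set `{v : v₀ = x₀}`. [folklore] -/
private theorem mem_lineA_iff_realize {F : Type} [Field F] [Fintype F] [DecidableEq F]
    [FirstOrder.Ring.CompatibleRing F] (y : Fin 0 → F) (x : Fin 1 → F) (v : Fin 2 → F) :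
    v ∈ lineA F x ↔ φA.Realize (Sum.elim (Sum.elim x v) y) := by
  rw [mem_lineA]
  simp [φA, Formula.realize_equal]

/-- Realisation of `φB`: `B_x = {0}`. [folklore] -/
private theorem mem_ptB_iff_realize {F : Type} [Field F] [FirstOrder.Ring.CompatibleRing F]
    (y : Fin 0 → F) (x : Fin 1 → F) (v : Fin 2 → F) :
    v ∈ ptB F x ↔ φB.Realize (Sum.elim (Sum.elim x v) y) := by
  rw [mem_ptB]
  simp [φB, Formula.realize_equal, Formula.realize_inf, funext_iff, Fin.forall_fin_two]

/-- Realisation of `φC`: `C_x = {(−x₀,−x₀)}`. [folklore] -/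
private theorem mem_ptC_iff_realize {F : Type} [Field F] [FirstOrder.Ring.CompatibleRing F]
    (y : Fin 0 → F) (x : Fin 1 → F) (v : Fin 2 → F) :
    v ∈ ptC F x ↔ φC.Realize (Sum.elim (Sum.elim x v) y) := by
  rw [mem_ptC]
  simp [φC, Formula.realize_equal, Formula.realize_inf, funext_iff, Fin.forall_fin_two,
    eq_neg_iff_add_eq_zero]

end Parasite

/-- Refutes `DefinableSTPPDichotomy.HexagonClearance` [refuted-misstated]: the item asks hexagon
clearance for EVERY `ε > 0` in EVERY large finite field, but for `ε > 1` label-only parasite families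
(`A_x` a line, `B_x`, `C_x` points in `F²`, `x ∈ F`) meet both hypotheses, and over `F = GF(3ⁿ)` a
fully-STPP sub-family is exactly a cap set, of size `≤ 3·q^{1−c₃}` (Ellenberg–Gijswijt / BCCGNSU
Thm 4.14, tree: `card_le_rpow_of_elementary`) — short of the demanded `q^{1−δ}` at `δ = c₃/2`.
Witness: `e = 1, m = 2, k = 0`, `φ_A : v₀ = x₀`, `φ_B : v = 0`, `φ_C : v₀ + x₀ = 0 ∧ v₁ + x₀ = 0`,
`ε = 4, η = 1, δ = foxLovaszExponent 3 / 2`, field `GF(3ⁿ)`, `n = q₁ + ⌈2/c₃⌉ + 1`.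
Repaired statement C′ (what `closes` actually uses, at `ε = min(ω−2, 1)`): insert `ε ≤ 1 →` after
`0 < ε →` (the parasite's mass is `q^{(5+ε)/3} ≤ q² < q^{2+η}` for `ε ≤ 1`, so this witness misses
C′); independently/also `q₁ ≤ ringChar F` in place of `q₁ ≤ Fintype.card F` (large characteristic,
the route's own regime `char F → ∞`: in characteristic `p` and for `ε ≤ 3c_p` the tree's
`BCCGNSU2017_thmB_elementary` caps every fully-STPP `J` at mass `≤ q^m`, so there the item can only
hold vacuously) — the witness misses that repair too. [folklore] -/
theorem DefinableSTPPDichotomyHexagonClearance_refuted :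
    ¬ Summit.MatrixMultiplication.MatrixMultiplication.Theses.DefinableSTPPDichotomy.HexagonClearance := by
  intro H
  classical
  -- the cap-set exponent `c = c₃ > 0`
  have hc : 0 < Literature.Combinatorics.Additive.foxLovaszExponent 3 :=
    Literature.Combinatorics.Additive.foxLovaszExponent_pos (by norm_num)
  generalize hcdef : Literature.Combinatorics.Additive.foxLovaszExponent 3 = c at hc
  obtain ⟨q₁, hq₁⟩ := H 1 2 0 ⊤ (φA) (φB) (φC) 4 1 (c / 2) (by norm_num) one_pos (half_pos hc)
  -- the field `GF(3ⁿ)`, `n = q₁ + ⌈2/c⌉ + 1`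
  obtain ⟨n, hn0, hq₁n, hn2⟩ : ∃ n : ℕ, n ≠ 0 ∧ q₁ ≤ n ∧ (2 / c : ℝ) < n :=
    ⟨q₁ + ⌈2 / c⌉₊ + 1, by omega, by omega, Nat.lt_of_ceil_lt (by omega)⟩
  let F := GaloisField 3 n
  letI : Fintype F := Fintype.ofFinite F
  letI : FirstOrder.Ring.CompatibleRing F := FirstOrder.Ring.compatibleRingOfRing F
  have hcardF : Fintype.card F = 3 ^ n := by
    rw [← Nat.card_eq_fintype_card]
    exact GaloisField.card 3 n hn0
  have hF : q₁ ≤ Fintype.card F := by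
    rw [hcardF]
    exact hq₁n.trans (Nat.lt_pow_self (by norm_num)).le
  have hQpos : (0 : ℝ) < Fintype.card F := by exact_mod_cast Fintype.card_pos
  have h3 : (3 : F) = 0 := by
    have h := CharP.cast_eq_zero F 3
    simpa using h
  have hG : ∀ x : F, 3 • x = 0 := fun x => by
    rw [nsmul_eq_mul, Nat.cast_ofNat, h3, zero_mul]
  -- instantiate the item at the parasite family
  have key := hq₁ F hF ![] univ (lineA F) (ptB F) (ptC F) (fun x => by simp)
    (mem_lineA_iff_realize ![]) (mem_ptB_iff_realize ![]) (mem_ptC_iff_realize ![])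
  obtain ⟨J, -, hJstpp, hJmass⟩ := key
    (by
      intro i _ j _ k _ hcase s hs s' hs' t ht t' ht' u hu u' hu' hsum
      rw [mem_lineA] at hs hs'
      rw [mem_ptB] at ht ht'
      rw [mem_ptC] at hu hu'
      subst ht ht' hu hu'
      have e0 := congrFun hsum 0
      have e1 := congrFun hsum 1
      simp only [Pi.add_apply, Pi.sub_apply, Pi.zero_apply] at e0 e1
      have hijk : i 0 = j 0 ∧ j 0 = k 0 := by
        rcases hcase with h | h | h
        · have h0 := congrFun h 0
          exact ⟨h0, by linear_combination (j 0 - k 0) * h3 - e0 + hs' - hs + h0⟩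
        · have h0 := congrFun h 0
          exact ⟨by linear_combination e0 - hs' + hs - 2 * h0, h0⟩
        · have h0 := congrFun h 0
          exact ⟨by linear_combination hs' - e0 - hs - 2 * h0,
            by linear_combination e0 - hs' + hs + h0⟩
      have hij : i = j := funext fun l => by rw [Fin.fin_one_eq_zero l]; exact hijk.1
      have hjk : j = k := funext fun l => by rw [Fin.fin_one_eq_zero l]; exact hijk.2
      refine ⟨hij, hjk, funext (Fin.forall_fin_two.2 ⟨?_, ?_⟩), rfl, by rw [hjk]⟩
      · linear_combination hs - hs' - hijk.1 - hijk.2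
      · linear_combination hijk.2 - e1)
    (by
      simp only [card_lineA, card_ptB, card_ptC, mul_one, sum_const, card_univ, Fintype.card_fun,
        Fintype.card_fin, pow_one, nsmul_eq_mul, Nat.cast_ofNat]
      rw [show ((2 : ℝ) + 4) / 3 = 2 by norm_num, show (2 : ℝ) + 1 = 1 + 2 by norm_num,
        Real.rpow_add hQpos, Real.rpow_one])
  -- a fully-STPP sub-family is a tricolored sum-free set `(x, x, x)_{x ∈ J}` in `(F,+)`, `3·F = 0`
  have hTSF : Literature.Combinatorics.Additive.IsTricoloredSumFree
      (fun a : ↥J => (a.1 0 : F)) (fun a : ↥J => a.1 0) (fun a : ↥J => a.1 0) := by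
    intro a b d
    constructor
    · intro hsum
      have h := hJstpp a.1 a.2 b.1 b.2 d.1 d.2 (fun _ => d.1 0) (by simp [mem_lineA])
        (fun _ => a.1 0) (by simp [mem_lineA]) 0 (by simp [mem_ptB]) 0 (by simp [mem_ptB])
        (fun _ => -(b.1 0)) (by simp [mem_ptC]) (fun _ => -(d.1 0)) (by simp [mem_ptC])
        (by
          funext l
          simp only [Pi.add_apply, Pi.sub_apply, Pi.zero_apply]
          linear_combination hsum - (d.1 0) * h3)
      exact ⟨Subtype.ext h.1, Subtype.ext h.2.1⟩
    · rintro ⟨rfl, rfl⟩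
      linear_combination (a.1 0) * h3
  have hJle := Literature.Barriers.MatrixMultiplication.card_le_rpow_of_elementary
    Nat.prime_three F hG ↥J _ _ _ hTSF
  rw [Fintype.card_coe, hcdef] at hJle
  -- the mass of `J`
  simp only [card_lineA, card_ptB, card_ptC, mul_one, sum_const, nsmul_eq_mul,
    Nat.cast_ofNat] at hJmass
  -- `3 < q^{c/2}` since `q = 3ⁿ`, `n c / 2 > 1`
  have h3lt : (3 : ℝ) < (Fintype.card F : ℝ) ^ (c / 2) := by
    have hQ3 : (Fintype.card F : ℝ) = (3 : ℝ) ^ (n : ℝ) := by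
      rw [hcardF]
      push_cast
      exact (Real.rpow_natCast 3 n).symm
    have h1lt : (1 : ℝ) < n * (c / 2) := by
      have h1 : (2 / c) * (c / 2) = (1 : ℝ) := by field_simp
      calc (1 : ℝ) = (2 / c) * (c / 2) := h1.symm
        _ < n * (c / 2) := by gcongr
    rw [hQ3, ← Real.rpow_mul (by norm_num : (0 : ℝ) ≤ 3)]
    calc (3 : ℝ) = 3 ^ (1 : ℝ) := (Real.rpow_one 3).symm
      _ < 3 ^ ((n : ℝ) * (c / 2)) := Real.rpow_lt_rpow_of_exponent_lt (by norm_num) h1lt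
  -- contradiction: q^{3 - c/2} ≤ |J| q² ≤ 3 q^{1-c} q² < q^{c/2} q^{1-c} q² = q^{3 - c/2}
  have key2 : (Fintype.card F : ℝ) ^ ((2 : ℝ) + 1 - c / 2) <
      (Fintype.card F : ℝ) ^ ((2 : ℝ) + 1 - c / 2) :=
    calc (Fintype.card F : ℝ) ^ ((2 : ℝ) + 1 - c / 2)
        ≤ (J.card : ℝ) * (Fintype.card F : ℝ) ^ (((2 : ℝ) + 4) / 3) := hJmass
      _ ≤ 3 * (Fintype.card F : ℝ) ^ (1 - c) * (Fintype.card F : ℝ) ^ (((2 : ℝ) + 4) / 3) :=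
          mul_le_mul_of_nonneg_right hJle (Real.rpow_nonneg hQpos.le _)
      _ < (Fintype.card F : ℝ) ^ (c / 2) * (Fintype.card F : ℝ) ^ (1 - c) *
            (Fintype.card F : ℝ) ^ (((2 : ℝ) + 4) / 3) :=
          mul_lt_mul_of_pos_right (mul_lt_mul_of_pos_right h3lt (Real.rpow_pos_of_pos hQpos _))
            (Real.rpow_pos_of_pos hQpos _)
      _ = (Fintype.card F : ℝ) ^ (c / 2 + (1 - c) + ((2 : ℝ) + 4) / 3) := by
          rw [Real.rpow_add hQpos, Real.rpow_add hQpos]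
      _ = (Fintype.card F : ℝ) ^ ((2 : ℝ) + 1 - c / 2) := by
          congr 1
          ring
  exact lt_irrefl _ key2

end

end Summit.MatrixMultiplication.MatrixMultiplication.Theorems
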